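import Summits.AnomalousDissipation.AnomalousDissipation.Theorems.SolenoidalFractalHomogenisationLagrangianStepCellGridProjection
import Summits.AnomalousDissipation.AnomalousDissipation.Theorems.SolenoidalFractalHomogenisationLagrangianStepCellClauseCutsW
import Literature.Analysis.FluidPDE.PassiveVectorTensorSlowLeakage
import HarnessLib

/-!
# K1L tensor cell package — clause (F_T): window-local slow leakage of fluctuation data, with explicit constants

Helper file for the crux `LagrangianRenormalisationStep` (route `SolenoidalFractalHomogenisation`, item `stmt-AnomalousDissipation-24912`,
line «onelevel», stub `stub_cellEnergyT`).  Clause (F_T) of `CellEnergyClausesWNoE` (the window-local re-cut of record, D24-4 / F-lead-1 /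
F-p4g9-3): a class datum `F` with no modes below `n/2` generates, along the `1/n`-periodic cell carrier, weak tensor solutions whose slow energy obeys
`lowEnergy L (u t) ≤ (144k²Λ²/(π⁴lo²c))·(cL²/(n²ν²))·exp((36k²Λ/(π²lo))·(L²/(n²ν))·t)·‖F‖²` for every `L > 0` with `L⌈K/ν⌉ ≤ n`
(`cell_slow_leakage`, any `0 < ν₀`, `K > 2ν₀`).  Mechanism: project onto the union of the Bloch sectors meeting `{‖k‖ ≤ L}` with the
grid-character combination of `…CellGridProjection` (a weak solution from the projected datum, which vanishes on the block; off the block its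
modes have `|k|² ≥ n²/4`), and apply the Literature brick `IsWeakTensorPassiveVectorOn.ae_block_energy_le_of_datum_off_block` (energy
equality − block identity + flux-sees-complement + two-scale Grönwall) with `M = k/(2πn)`, `κ₀ = L`, `ρ = n²/4`, `lo' = ν lo/(λn²)`.
Together with the landed corrector-content clause (C) (`cell_corrector_content`, p634914) this gives `CellEnergyClausesWNoE` with one explicit
constant (`cellEnergyClausesWNoE_holds`) — the conclusion of `stub_cellEnergyT` in the v2 typing of record.  Not the crux; says nothing about
anomalous dissipation.  Prover seat `lead-k1l-onelevel-p1` g0.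
-/

set_option linter.dupNamespace false

noncomputable section

namespace Summit.AnomalousDissipation.AnomalousDissipation.Theorems.SolenoidalFractalHomogenisation.LagrangianStep

open Literature.Analysis Literature.Analysis.FluidPDE Literature.Analysis.FunctionSpaces
open Literature.Analysis.FluidPDE.LatticeShear
open MeasureTheory Set Filter Function UnitAddTorus
open scoped ENNReal NNReal InnerProductSpace
open Summit.AnomalousDissipation.AnomalousDissipation.Theorems.SolenoidalFractalHomogenisation.RealisedQuasiStaticCellLaw

/-! ## §1 The slow block `{‖k‖ ≤ L}` -/

/-- `‖latticeVec (−k)‖ = ‖latticeVec k‖`. [folklore] -/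
theorem norm_latticeVec_neg (k : Fin 3 → ℤ) : ‖Torus.latticeVec (-k)‖ = ‖Torus.latticeVec k‖ := by
  rw [← Real.sqrt_sq (norm_nonneg _), ← Real.sqrt_sq (norm_nonneg (Torus.latticeVec k)),
    norm_latticeVec_sq', norm_latticeVec_sq', FunctionSpaces.Torus.freqNormSq_neg]

open Classical in
/-- Membership in the index set of `lowEnergy L`. [folklore] -/
theorem mem_lowSet_iff {L : ℝ} {k : Fin 3 → ℤ} :
    k ∈ (Fintype.piFinset fun _ : Fin 3 => Finset.Icc (-⌈L⌉) ⌈L⌉).filter (fun k => ‖Torus.latticeVec k‖ ≤ L) ↔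
      ‖Torus.latticeVec k‖ ≤ L := by
  refine ⟨fun h => (Finset.mem_filter.1 h).2, fun hk => ?_⟩
  refine Finset.mem_filter.2 ⟨Fintype.mem_piFinset.2 fun i => Finset.mem_Icc.2 ?_, hk⟩
  have h1 : |(k i : ℝ)| ≤ L := (abs_coord_le_norm_latticeVec k i).trans hk
  have h2 : |(k i : ℝ)| ≤ ⌈L⌉ := h1.trans (Int.le_ceil L)
  have h3 : |k i| ≤ ⌈L⌉ := by exact_mod_cast h2
  exact abs_le.1 h3

open Classical in
/-- `lowEnergy L f = Σ_{‖k‖ ≤ L} ‖𝓕(complexify ∘ f)(k)‖²` (integrable `f`). [folklore] -/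
theorem lowEnergy_eq_sum_norm_sq (L : ℝ) {f : VF} (hf : Integrable f volume) :
    lowEnergy L f = ∑ k ∈ (Fintype.piFinset fun _ : Fin 3 => Finset.Icc (-⌈L⌉) ⌈L⌉).filter (fun k => ‖Torus.latticeVec k‖ ≤ L),
      ‖mFourierCoeff (FunctionSpaces.EuclideanSpace.complexify ∘ f) k‖ ^ 2 := by
  unfold lowEnergy
  exact Finset.sum_congr rfl fun k _ => sectorEnergy_eq hf k


/-! ## §2 Clause (F_T) with explicit constants -/

open Classical in
/-- **Window-local slow leakage of fluctuation data (clause (F_T) of `CellEnergyClausesWNoE`, explicit constants).**  For the design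
`W.stretch M` with bookkept gain `c > 0`, window `(lo, hi, Λ, β)` with `lo > 0`, `Λ ≥ 1`, and ANY `0 < ν₀`, `K > 2ν₀`: for every
`ν ∈ (0, ν₀)`, `n`, constant tensor `𝔸` with `OddSmall 𝔸 (νβ)` and `NearIso 𝔸 (ν lo/λ) (ν hi λ)` for some `λ ∈ [1, Λ]`, every `L > 0` with
`L⌈K/ν⌉ ≤ n`, every class datum `F` with no modes below `n/2`, `T > 0` and every weak solution `u` of the cell problem from `F`:
`lowEnergy L (u t) ≤ (144k²Λ²/(π⁴lo²c))·(cL²/(n²ν²))·exp((36k²Λ/(π²lo))·(L²/(n²ν))·t)·∫‖F‖²` for a.e. `t ∈ (0,T)`.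
[cite: RobinsonRodrigoSadowski2016, §4.2 (4.20)] -/
theorem cell_slow_leakage {k : ℕ} (W : LatticeWord k) (M : ℝ) (hM : 0 < M) {c : ℝ} (hc : 0 < c)
    {lo hi Λ β : ℝ} (hlo : 0 < lo) (hΛ : 1 ≤ Λ) {ν₀ K : ℝ} (hν₀ : 0 < ν₀) (hK : 2 * ν₀ < K) :
    ∀ ν, ∀ hν : ν ∈ Set.Ioo 0 ν₀, ∀ n : ℕ, ∀ 𝔸 : Torus.Visc4 (Fin 3),
      Torus.OddSmall 𝔸 (ν * β) → (∃ lam ∈ Set.Icc (1:ℝ) Λ, Torus.NearIso 𝔸 (ν * (lo / lam)) (ν * (hi * lam))) →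
      ∀ L > (0:ℝ), L * (⌈K / ν⌉₊ : ℝ) ≤ n → ∀ F : VF, IsDatum F →
        (∀ k' : Fin 3 → ℤ, ‖Torus.latticeVec k'‖ < (n:ℝ) / 2 → ∀ i, modeCoeff k' F i = 0) →
        ∀ T > (0:ℝ), ∀ u : ℝ → VF,
          Torus.IsWeakTensorPassiveVectorOn 0 T ((1 / (n:ℝ) ^ 2) • 𝔸) (cellField W M hM ν hν.1 n) F u →
          ∀ᵐ t ∂(volume.restrict (Ioo 0 T)),
            lowEnergy L (u t) ≤ (144 * (k:ℝ) ^ 2 * Λ ^ 2 / (Real.pi ^ 4 * lo ^ 2 * c)) * (c * L ^ 2 / ((n:ℝ) ^ 2 * ν ^ 2)) *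
              Real.exp ((36 * (k:ℝ) ^ 2 * Λ / (Real.pi ^ 2 * lo)) * (L ^ 2 / ((n:ℝ) ^ 2 * ν)) * t) * ∫ x, ‖F x‖ ^ 2 := by
  intro ν hν n 𝔸 _hodd hwin L hL hband F hF hFfast T _hT u hu
  obtain ⟨lam, hlam, hA⟩ := hwin
  have hlam1 : 0 < lam := lt_of_lt_of_le one_pos hlam.1
  have hνpos : 0 < ν := hν.1
  have hKpos : 0 < K := by linarith
  -- ### the slow band: `n ≥ 1`, `3L ≤ n`
  have hKν : (3:ℝ) ≤ (⌈K / ν⌉₊ : ℝ) := by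
    have h1 : (2:ℝ) < K / ν := by
      rw [lt_div_iff₀ hνpos]
      linarith [hν.2]
    have h2 : 2 < ⌈K / ν⌉₊ := Nat.lt_ceil.2 (by exact_mod_cast h1)
    exact_mod_cast h2
  have hn1 : 1 ≤ (n:ℝ) := one_le_of_band hL hKpos hνpos hband
  have hn : 0 < n := by exact_mod_cast (show (0:ℝ) < n by linarith)
  have hL3 : 3 * L ≤ n := by nlinarith
  have hLhalf : L < (n:ℝ) / 2 := by linarith
  -- ### the data of the Literature brick
  have hFl2 : MemLp F 2 volume := memLp_two_of_memSobolev_one_complexify hF.1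
  have hFi : Integrable F volume := hFl2.integrable one_le_two
  have hN : Torus.NearIso ((1 / (n:ℝ) ^ 2) • 𝔸) ((1 / (n:ℝ) ^ 2) * (ν * (lo / lam))) ((1 / (n:ℝ) ^ 2) * (ν * (hi * lam))) :=
    hA.smul (by positivity)
  have hlo' : 0 < (1 / (n:ℝ) ^ 2) * (ν * (lo / lam)) := by positivity
  have hb : MemLp (FunctionSpaces.Torus.stLift (cellField W M hM ν hν.1 n)) ∞
      (volume.restrict (Ioo 0 T ×ˢ (univ : Set (EuclideanSpace ℝ (Fin 3))))) := by
    unfold cellField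
    exact memLp_top_stLift_cell _ n T
  have hMb : 0 ≤ (k:ℝ) / (2 * Real.pi * n) := by positivity
  have hbM : ∀ᵐ s ∂(volume.restrict (Ioo 0 T)), ∀ᵐ x ∂volume, ‖cellField W M hM ν hν.1 n s x‖ ≤ (k:ℝ) / (2 * Real.pi * n) :=
    ae_of_all _ fun s => ae_of_all _ fun x => by unfold cellField; exact norm_cell_le_div _ hn s x
  -- the grid and the weights
  obtain ⟨g, hg⟩ : ∃ g : (Fin 3 → Fin n) → UnitAddTorus (Fin 3),
      g = fun j i => ((((j i : ℕ) : ℝ) / n : ℝ) : UnitAddCircle) := ⟨_, rfl⟩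
  have hper : ∀ (j : Fin 3 → Fin n) t x, cellField W M hM ν hν.1 n t (x + g j) = cellField W M hM ν hν.1 n t x := by
    intro j t x
    rw [hg]
    unfold cellField
    exact cell_add_grid _ hn j t x
  -- ### the slow block
  obtain ⟨S, hS_def⟩ : ∃ S : Finset (Fin 3 → ℤ),
      S = (Fintype.piFinset fun _ : Fin 3 => Finset.Icc (-⌈L⌉) ⌈L⌉).filter (fun k => ‖Torus.latticeVec k‖ ≤ L) := ⟨_, rfl⟩
  have hmemS : ∀ k', k' ∈ S ↔ ‖Torus.latticeVec k'‖ ≤ L := fun k' => by rw [hS_def]; exact mem_lowSet_iff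
  have hSsym : ∀ k' ∈ S, -k' ∈ S := fun k' hk' => by
    rw [hmemS] at hk' ⊢
    rwa [norm_latticeVec_neg]
  have hℓi : ∀ ℓ₀ ∈ S, ∀ i, 2 * |(ℓ₀ i : ℝ)| ≤ n := fun ℓ₀ hℓ₀ i => by
    have h1 := (hmemS ℓ₀).1 hℓ₀
    linarith [abs_coord_le_norm_latticeVec ℓ₀ i]
  have hSsmall : ∀ ℓ₀ ∈ S, ∀ i, 2 * |ℓ₀ i| < (n:ℤ) := fun ℓ₀ hℓ₀ i => by
    have h1 := (hmemS ℓ₀).1 hℓ₀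
    have h2 : 2 * |(ℓ₀ i : ℝ)| < n := by linarith [abs_coord_le_norm_latticeVec ℓ₀ i]
    exact_mod_cast h2
  have hSκ : ∀ k' ∈ S, FunctionSpaces.Torus.freqNormSq k' ≤ L ^ 2 := fun k' hk' => by
    rw [← norm_latticeVec_sq']
    exact pow_le_pow_left₀ (norm_nonneg _) ((hmemS k').1 hk') 2
  -- the weights and their multiplier
  obtain ⟨cW, hcW⟩ : ∃ cW : (Fin 3 → Fin n) → ℝ,
      cW = fun j => 1 / (n:ℝ) ^ 3 * ∑ ℓ₀ ∈ S, Real.cos (2 * Real.pi * (∑ i, (ℓ₀ i : ℝ) * ((j i : ℕ) : ℝ)) / n) := ⟨_, rfl⟩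
  have hmult : ∀ k' : Fin 3 → ℤ, (∑ j, (cW j : ℂ) * UnitAddTorus.mFourier k' (g j)) =
      ((S.filter fun ℓ₀ => ∀ i, (n:ℤ) ∣ k' i - ℓ₀ i).card : ℂ) := by
    intro k'
    rw [hcW, hg]
    exact gridMultiplier_eq hn S hSsym k'
  have hmult1 : ∀ k', ‖∑ j, (cW j : ℂ) * UnitAddTorus.mFourier k' (g j)‖ ≤ 1 := fun k' => by
    rw [hmult k', Complex.norm_natCast]
    exact_mod_cast card_filter_dvd_sub_le_one S hSsmall k'
  have hmultS : ∀ k' ∈ S, (∑ j, (cW j : ℂ) * UnitAddTorus.mFourier k' (g j)) = 1 := fun k' hk' => by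
    rw [hmult k', card_filter_dvd_sub_eq_one_of_mem S hSsmall hk', Nat.cast_one]
  -- ### the projected problem
  haveI : NeZero n := ⟨hn.ne'⟩
  have hPsol : Torus.IsWeakTensorPassiveVectorOn 0 T ((1 / (n:ℝ) ^ 2) • 𝔸) (cellField W M hM ν hν.1 n)
      (fun x => ∑ j, cW j • F (x + g j)) (fun t x => ∑ j, cW j • u t (x + g j)) :=
    hu.sum_smul_translate' g cW hper hFi
  have hPF2 : MemLp (fun x => ∑ j, cW j • F (x + g j)) 2 volume := memLp_two_sum_smul_translate g cW hFl2
  have hPFdiv : FunctionSpaces.Torus.IsWeaklyDivFree (fun x => ∑ j, cW j • F (x + g j)) :=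
    isWeaklyDivFree_sum_smul_translate g cW hF.2.2 hFi
  -- the datum vanishes below `n/2`, hence on the block; the projected datum too
  have hFzero : ∀ k', ‖Torus.latticeVec k'‖ < (n:ℝ) / 2 → mFourierCoeff (FunctionSpaces.EuclideanSpace.complexify ∘ F) k' = 0 := by
    intro k' hk'
    ext i
    rw [← modeCoeff_eq hFi]
    simpa using hFfast k' hk' i
  have hS₀ : ∀ k' ∈ S, mFourierCoeff (FunctionSpaces.EuclideanSpace.complexify ∘ fun x => ∑ j, cW j • F (x + g j)) k' = 0 := by
    intro k' hk'
    rw [Torus.mFourierCoeff_complexify_sum_smul_translate' g cW hFi k',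
      hFzero k' (lt_of_le_of_lt ((hmemS k').1 hk') hLhalf), smul_zero]
  -- off the block the projected solution lives on `|k|² ≥ n²/4`
  have hρ : 0 < (n:ℝ) ^ 2 / 4 := by positivity
  have hgap : ∀ᵐ s ∂(volume.restrict (Ioo 0 T)), ∀ k', k' ∉ S →
      mFourierCoeff (FunctionSpaces.EuclideanSpace.complexify ∘ fun x => ∑ j, cW j • u s (x + g j)) k' ≠ 0 →
        (n:ℝ) ^ 2 / 4 ≤ FunctionSpaces.Torus.freqNormSq k' := by
    filter_upwards [hu.ae_integrable_slice] with s hsi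
    intro k' hk' hne
    rw [Torus.mFourierCoeff_complexify_sum_smul_translate' g cW hsi.1 k', hmult k'] at hne
    have hN0 : (S.filter fun ℓ₀ => ∀ i, (n:ℤ) ∣ k' i - ℓ₀ i).card ≠ 0 := by
      intro h0
      apply hne
      rw [h0, Nat.cast_zero, zero_smul]
    obtain ⟨ℓ₀, hℓ₀S, hdvd⟩ := exists_of_card_filter_dvd_sub_ne_zero S hN0
    have hk1 : k' ≠ ℓ₀ := fun h => hk' (by rw [h]; exact hℓ₀S)
    have hk2 : k' ≠ -ℓ₀ := fun h => hk' (by rw [h]; exact hSsym ℓ₀ hℓ₀S)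
    exact freqNormSq_ge_of_sector (hℓi ℓ₀ hℓ₀S) (Or.inl hdvd) hk1 hk2
  -- ### the Literature brick
  have hres := hPsol.ae_block_energy_le_of_datum_off_block hN hlo' hPF2 hPFdiv hb hMb hbM S hSsym hS₀ hL.le hSκ hρ hgap
  -- ### back to `u`: on the block the projection is the identity; the projected datum has less energy
  have hEP : ∫ x, ‖∑ j, cW j • F (x + g j)‖ ^ 2 ≤ ∫ x, ‖F x‖ ^ 2 := integral_norm_sq_sum_smul_translate_le g cW hFl2 hmult1
  have hEPnn : 0 ≤ ∫ x, ‖∑ j, cW j • F (x + g j)‖ ^ 2 := integral_nonneg fun x => sq_nonneg _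
  -- constants
  have hπ : Real.pi ≠ 0 := Real.pi_pos.ne'
  have hnr : (n:ℝ) ≠ 0 := by positivity
  have hA₀ : (2 * Fintype.card (Fin 3) * ((k:ℝ) / (2 * Real.pi * n)) * L) ^ 2 /
        (Real.pi * ((1 / (n:ℝ) ^ 2) * (ν * (lo / lam))) * ((n:ℝ) ^ 2 / 4)) ^ 2 =
      144 * (k:ℝ) ^ 2 * lam ^ 2 * L ^ 2 / (Real.pi ^ 4 * lo ^ 2 * (n:ℝ) ^ 2 * ν ^ 2) := by
    simp only [Fintype.card_fin, Nat.cast_ofNat]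
    field_simp
    ring
  have hB₀ : (2 * Fintype.card (Fin 3) * ((k:ℝ) / (2 * Real.pi * n)) * L) ^ 2 /
        (((1 / (n:ℝ) ^ 2) * (ν * (lo / lam))) * ((n:ℝ) ^ 2 / 4)) =
      36 * (k:ℝ) ^ 2 * lam * L ^ 2 / (Real.pi ^ 2 * lo * (n:ℝ) ^ 2 * ν) := by
    simp only [Fintype.card_fin, Nat.cast_ofNat]
    field_simp
    ring
  have hA₁ : (144 * (k:ℝ) ^ 2 * Λ ^ 2 / (Real.pi ^ 4 * lo ^ 2 * c)) * (c * L ^ 2 / ((n:ℝ) ^ 2 * ν ^ 2)) =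
      144 * (k:ℝ) ^ 2 * Λ ^ 2 * L ^ 2 / (Real.pi ^ 4 * lo ^ 2 * (n:ℝ) ^ 2 * ν ^ 2) := by
    field_simp
  have hB₁ : (36 * (k:ℝ) ^ 2 * Λ / (Real.pi ^ 2 * lo)) * (L ^ 2 / ((n:ℝ) ^ 2 * ν)) =
      36 * (k:ℝ) ^ 2 * Λ * L ^ 2 / (Real.pi ^ 2 * lo * (n:ℝ) ^ 2 * ν) := by
    field_simp
  have hAle : 144 * (k:ℝ) ^ 2 * lam ^ 2 * L ^ 2 / (Real.pi ^ 4 * lo ^ 2 * (n:ℝ) ^ 2 * ν ^ 2) ≤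
      144 * (k:ℝ) ^ 2 * Λ ^ 2 * L ^ 2 / (Real.pi ^ 4 * lo ^ 2 * (n:ℝ) ^ 2 * ν ^ 2) := by
    have : lam ^ 2 ≤ Λ ^ 2 := pow_le_pow_left₀ hlam1.le hlam.2 2
    have hden : 0 < Real.pi ^ 4 * lo ^ 2 * (n:ℝ) ^ 2 * ν ^ 2 := by positivity
    exact div_le_div_of_nonneg_right (by nlinarith [sq_nonneg ((k:ℝ) * L)]) hden.le
  have hBle : 36 * (k:ℝ) ^ 2 * lam * L ^ 2 / (Real.pi ^ 2 * lo * (n:ℝ) ^ 2 * ν) ≤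
      36 * (k:ℝ) ^ 2 * Λ * L ^ 2 / (Real.pi ^ 2 * lo * (n:ℝ) ^ 2 * ν) := by
    have hden : 0 < Real.pi ^ 2 * lo * (n:ℝ) ^ 2 * ν := by positivity
    exact div_le_div_of_nonneg_right (by nlinarith [sq_nonneg ((k:ℝ) * L), hlam.2]) hden.le
  have hA₁nn : 0 ≤ 144 * (k:ℝ) ^ 2 * Λ ^ 2 * L ^ 2 / (Real.pi ^ 4 * lo ^ 2 * (n:ℝ) ^ 2 * ν ^ 2) := by positivity
  -- ### conclusion
  filter_upwards [hres, hu.ae_integrable_slice, ae_restrict_mem measurableSet_Ioo] with t ht hti htI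
  -- the block energy of the projection is `lowEnergy L (u t)`
  have hblock : ∑ k' ∈ S, ‖mFourierCoeff (FunctionSpaces.EuclideanSpace.complexify ∘ fun x => ∑ j, cW j • u t (x + g j)) k'‖ ^ 2 =
      lowEnergy L (u t) := by
    rw [lowEnergy_eq_sum_norm_sq L hti.1, ← hS_def]
    refine Finset.sum_congr rfl fun k' hk' => ?_
    rw [Torus.mFourierCoeff_complexify_sum_smul_translate' g cW hti.1 k', hmultS k' hk', one_smul]
  have ht' : lowEnergy L (u t) ≤ 144 * (k:ℝ) ^ 2 * lam ^ 2 * L ^ 2 / (Real.pi ^ 4 * lo ^ 2 * (n:ℝ) ^ 2 * ν ^ 2) *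
      Real.exp (36 * (k:ℝ) ^ 2 * lam * L ^ 2 / (Real.pi ^ 2 * lo * (n:ℝ) ^ 2 * ν) * t) *
        ∫ x, ‖∑ j, cW j • F (x + g j)‖ ^ 2 := by
    rw [← hblock, ← hA₀, ← hB₀]
    exact ht
  rw [hA₁, hB₁]
  have hexp : Real.exp (36 * (k:ℝ) ^ 2 * lam * L ^ 2 / (Real.pi ^ 2 * lo * (n:ℝ) ^ 2 * ν) * t) ≤
      Real.exp (36 * (k:ℝ) ^ 2 * Λ * L ^ 2 / (Real.pi ^ 2 * lo * (n:ℝ) ^ 2 * ν) * t) :=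
    Real.exp_le_exp.2 (mul_le_mul_of_nonneg_right hBle htI.1.le)
  calc lowEnergy L (u t) ≤ _ := ht'
    _ ≤ 144 * (k:ℝ) ^ 2 * Λ ^ 2 * L ^ 2 / (Real.pi ^ 4 * lo ^ 2 * (n:ℝ) ^ 2 * ν ^ 2) *
        Real.exp (36 * (k:ℝ) ^ 2 * Λ * L ^ 2 / (Real.pi ^ 2 * lo * (n:ℝ) ^ 2 * ν) * t) * ∫ x, ‖F x‖ ^ 2 := by
      refine mul_le_mul (mul_le_mul hAle hexp (Real.exp_pos _).le hA₁nn) hEP hEPnn (mul_nonneg hA₁nn (Real.exp_pos _).le)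


/-! ## §3 The cell-energy clauses (F_T) + (C) with one explicit constant -/

/-- **`CellEnergyClausesWNoE` holds** for the design `W.stretch M`, gain `c > 0`, window with `lo > 0`, `Λ ≥ 1`: with `ν₀ = 1`, `K = 3` and the
single constant `C = 9k²Λ²/(π⁴lo²c) + 144k²Λ²/(π⁴lo²c) + 36k²Λ/(π²lo)` (clause (F_T) by `cell_slow_leakage`, clause (C) by
`cell_corrector_content`). -/
theorem cellEnergyClausesWNoE_holds {k : ℕ} (W : LatticeWord k) (M : ℝ) (hM : 0 < M) {c : ℝ} (hc : 0 < c)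
    {lo hi Λ β : ℝ} (hlo : 0 < lo) (hΛ : 1 ≤ Λ) :
    ∃ C : ℝ, 0 ≤ C ∧ ∃ ν₀ > (0:ℝ), ∃ K > (0:ℝ), CellEnergyClausesWNoE W M hM c lo hi Λ β C ν₀ K := by
  have hΛ0 : 0 ≤ Λ := zero_le_one.trans hΛ
  have hCC : 0 ≤ 9 * (k:ℝ) ^ 2 * Λ ^ 2 / (Real.pi ^ 4 * lo ^ 2 * c) := by positivity
  have hCF : 0 ≤ 144 * (k:ℝ) ^ 2 * Λ ^ 2 / (Real.pi ^ 4 * lo ^ 2 * c) := by positivity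
  have hCe : 0 ≤ 36 * (k:ℝ) ^ 2 * Λ / (Real.pi ^ 2 * lo) := by positivity
  refine ⟨9 * (k:ℝ) ^ 2 * Λ ^ 2 / (Real.pi ^ 4 * lo ^ 2 * c) + 144 * (k:ℝ) ^ 2 * Λ ^ 2 / (Real.pi ^ 4 * lo ^ 2 * c) +
    36 * (k:ℝ) ^ 2 * Λ / (Real.pi ^ 2 * lo), by positivity, 1, one_pos, 3, by norm_num, ?_⟩
  intro ν hν n 𝔸 hodd hwin
  refine ⟨?_, ?_⟩
  · intro L hL hband F hF hFfast T hT u hu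
    have h := cell_slow_leakage W M hM hc hlo hΛ one_pos (by norm_num : (2:ℝ) * 1 < 3) ν hν n 𝔸 hodd hwin L hL hband F hF hFfast T hT u hu
    filter_upwards [h, ae_restrict_mem measurableSet_Ioo] with t ht htI
    have hx : 0 ≤ c * L ^ 2 / ((n:ℝ) ^ 2 * ν ^ 2) := by have := hν.1; positivity
    have hy : 0 ≤ L ^ 2 / ((n:ℝ) ^ 2 * ν) := by have := hν.1; positivity
    have hE : 0 ≤ ∫ x, ‖F x‖ ^ 2 := integral_nonneg fun x => sq_nonneg _
    have h1 : 144 * (k:ℝ) ^ 2 * Λ ^ 2 / (Real.pi ^ 4 * lo ^ 2 * c) ≤ 9 * (k:ℝ) ^ 2 * Λ ^ 2 / (Real.pi ^ 4 * lo ^ 2 * c) +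
        144 * (k:ℝ) ^ 2 * Λ ^ 2 / (Real.pi ^ 4 * lo ^ 2 * c) + 36 * (k:ℝ) ^ 2 * Λ / (Real.pi ^ 2 * lo) := by linarith
    have h2 : 36 * (k:ℝ) ^ 2 * Λ / (Real.pi ^ 2 * lo) ≤ 9 * (k:ℝ) ^ 2 * Λ ^ 2 / (Real.pi ^ 4 * lo ^ 2 * c) +
        144 * (k:ℝ) ^ 2 * Λ ^ 2 / (Real.pi ^ 4 * lo ^ 2 * c) + 36 * (k:ℝ) ^ 2 * Λ / (Real.pi ^ 2 * lo) := by linarith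
    have hexp : Real.exp (36 * (k:ℝ) ^ 2 * Λ / (Real.pi ^ 2 * lo) * (L ^ 2 / ((n:ℝ) ^ 2 * ν)) * t) ≤
        Real.exp ((9 * (k:ℝ) ^ 2 * Λ ^ 2 / (Real.pi ^ 4 * lo ^ 2 * c) + 144 * (k:ℝ) ^ 2 * Λ ^ 2 / (Real.pi ^ 4 * lo ^ 2 * c) +
          36 * (k:ℝ) ^ 2 * Λ / (Real.pi ^ 2 * lo)) * (L ^ 2 / ((n:ℝ) ^ 2 * ν)) * t) := by
      exact Real.exp_le_exp.2 (mul_le_mul_of_nonneg_right (mul_le_mul_of_nonneg_right h2 hy) htI.1.le)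
    refine ht.trans ?_
    exact mul_le_mul (mul_le_mul (mul_le_mul_of_nonneg_right h1 hx) hexp (Real.exp_pos _).le (by positivity)) le_rfl hE
      (by positivity)
  · intro ℓ hℓ hband p hp hpℓ T hT w hw
    have h := cell_corrector_content W M hM hc hlo hΛ one_pos (by norm_num : (1:ℝ) ≤ 3) ν hν n 𝔸 hodd hwin ℓ hℓ hband p hp hpℓ T hT w hw
    filter_upwards [h] with t ht
    have hx : 0 ≤ c * ‖Torus.latticeVec ℓ‖ ^ 2 / ((n:ℝ) ^ 2 * ν ^ 2) := by have := hν.1; positivity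
    have hE : 0 ≤ ∫ x, ‖(UnitAddTorus.mFourier ℓ x).re • p‖ ^ 2 := integral_nonneg fun x => sq_nonneg _
    have h1 : 9 * (k:ℝ) ^ 2 * Λ ^ 2 / (Real.pi ^ 4 * lo ^ 2 * c) ≤ 9 * (k:ℝ) ^ 2 * Λ ^ 2 / (Real.pi ^ 4 * lo ^ 2 * c) +
        144 * (k:ℝ) ^ 2 * Λ ^ 2 / (Real.pi ^ 4 * lo ^ 2 * c) + 36 * (k:ℝ) ^ 2 * Λ / (Real.pi ^ 2 * lo) := by linarith
    exact ht.trans (mul_le_mul_of_nonneg_right (mul_le_mul_of_nonneg_right h1 hx) hE)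

/-- **The warm-up stub's conclusion in the v2 typing of record** (`stub_cellEnergyT` with `CellEnergyClausesWNoE`): for every design word,
pre-stretch `M > 0`, gain `c > 0` and window `(lo, hi, Λ, β)` with `0 < lo ≤ 1 ≤ hi`, `1 < Λ`, `0 ≤ β` there are `C ≥ 0`, `ν₀, K > 0` with
`CellEnergyClausesWNoE W M hM c lo hi Λ β C ν₀ K`. -/
theorem cellEnergyT_W : ∀ k (W : LatticeWord k) (M : ℝ) (hM : 0 < M) (c : ℝ), 0 < c →
    ∀ lo hi Λ β : ℝ, 0 < lo → lo ≤ 1 → 1 ≤ hi → 1 < Λ → 0 ≤ β →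
      ∃ C : ℝ, 0 ≤ C ∧ ∃ ν₀ > (0:ℝ), ∃ K > (0:ℝ), CellEnergyClausesWNoE W M hM c lo hi Λ β C ν₀ K :=
  fun _ W M hM _ hc _ _ _ _ hlo _ _ hΛ _ => cellEnergyClausesWNoE_holds W M hM hc hlo hΛ.le

end Summit.AnomalousDissipation.AnomalousDissipation.Theorems.SolenoidalFractalHomogenisation.LagrangianStep

end
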